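import Summits.Parity.GeneralizedHardyLittlewood.Theorems.LiouvilleShiftedTablesTypeI2DilatedURB3

/-!
# The `𝔲_R` terms of the assembly (`stub_uRBound`), file 11: the decomposition of `λ` (Step D) and its numerics

Route `LiouvilleShiftedTables` (Parity / GeneralizedHardyLittlewood), crux `TypeI2Dilated` (stmt-Parity-14272), line
`peel-to-drappeau`, registered stub `stub_uRBound : URBound`; continuation of `…URB1`–`…URB3` (imports `…URB3`).

* `urb_decomp` — for `1 ≤ m ≤ Y ≤ 2x`, `λ(m) = ∑_{j=1}^{4} (−1)^{j+1} C(4,j) ∑_{κ} F_{j,κ}(m) + (1_{□,>K} ⋆ μ)(m)` (Heath-Brown's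
  identity for `λ = 1_□ ⋆ μ`, `Literature…HeathBrownLiouville.liouville_apply_eq` with `z = (2x)^{1/4}`, and the box
  expansion `BFI.prod_apply_eq_sum_prod_boxRestrict_apply` with `T = 2x`, `Δ = 1`, `K_b = log₂⌊2x⌋ + 1` boxes), whence
  `NS(λ) ≤ 6 ∑_{j ≤ 4} ∑_κ NS(F_{j,κ}) + NS(1_{□,>K} ⋆ μ)` by the subadditivity of `NS`;
* `urbKb_le` — `K_b ≤ (2/log 2) log x` for `x ≥ 4`; `urb_numerics` — `6 ∑_{j ≤ 4} K_b^{2j} + 1 ≤ x^ρ` for large `x`.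
[this line: Lines/peel-to-drappeau.md; cite: Heathbrown1982, Lemma 1; Drappeau2017, §6]
-/

noncomputable section

namespace Summit.Parity.GeneralizedHardyLittlewood.Cruxes.TypeI2Dilated.PeelToDrappeau

open Finset Fintype Real Filter
open scoped ArithmeticFunction.sigma ArithmeticFunction.Moebius Classical
open Literature.NumberTheory.Sieve Literature.NumberTheory.Sieve.Drappeau2017

/-! ### The number of boxes -/

/-- The number of dyadic boxes below `2x`: `K_b = log₂⌊2x⌋ + 1`, so that `2x < 2^{K_b}`. [this line] -/
def urbKb (x : ℝ) : ℕ := Nat.log 2 ⌊2 * x⌋₊ + 1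

/-- `2x < 2^{K_b}`. [this line] -/
theorem two_mul_lt_two_pow_urbKb (x : ℝ) : 2 * x < (1 + 1 : ℝ) ^ urbKb x := by
  have h1 : ⌊2 * x⌋₊ < 2 ^ urbKb x := Nat.lt_pow_succ_log_self (by norm_num) _
  have h2 : 2 * x < (⌊2 * x⌋₊ : ℝ) + 1 := Nat.lt_floor_add_one _
  have h3 : ((⌊2 * x⌋₊ : ℕ) : ℝ) + 1 ≤ ((2 ^ urbKb x : ℕ) : ℝ) := by exact_mod_cast h1
  push_cast at h3
  norm_num
  linarith

/-- `K_b ≤ (2/log 2) log x` for `x ≥ 4`. [this line] -/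
theorem urbKb_le {x : ℝ} (hx : 4 ≤ x) : (urbKb x : ℝ) ≤ 2 / Real.log 2 * Real.log x := by
  have hlog2 : 0 < Real.log 2 := Real.log_pos one_lt_two
  have hx0 : 0 < x := by linarith
  have hn0 : ⌊2 * x⌋₊ ≠ 0 := Nat.pos_iff_ne_zero.1 (Nat.floor_pos.2 (by linarith))
  -- `log 2 · Nat.log 2 ⌊2x⌋ ≤ log (2x)`
  have h1 : (Nat.log 2 ⌊2 * x⌋₊ : ℝ) * Real.log 2 ≤ Real.log (2 * x) := by
    have hp := Nat.pow_log_le_self 2 hn0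
    have hp' : ((2 ^ Nat.log 2 ⌊2 * x⌋₊ : ℕ) : ℝ) ≤ (⌊2 * x⌋₊ : ℝ) := by exact_mod_cast hp
    push_cast at hp'
    have hfl : (⌊2 * x⌋₊ : ℝ) ≤ 2 * x := Nat.floor_le (by linarith)
    calc (Nat.log 2 ⌊2 * x⌋₊ : ℝ) * Real.log 2 = Real.log ((2 : ℝ) ^ Nat.log 2 ⌊2 * x⌋₊) := by
          rw [Real.log_pow]
      _ ≤ Real.log (2 * x) := Real.log_le_log (by positivity) (hp'.trans hfl)
  have h2 : Real.log (2 * x) = Real.log 2 + Real.log x := Real.log_mul (by norm_num) hx0.ne'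
  have h4 : Real.log 4 ≤ Real.log x := Real.log_le_log (by norm_num) hx
  have h44 : Real.log 4 = 2 * Real.log 2 := by
    rw [show (4 : ℝ) = 2 ^ 2 by norm_num, Real.log_pow]; norm_num
  unfold urbKb
  push_cast
  rw [div_mul_eq_mul_div, le_div_iff₀ hlog2]
  nlinarith

/-- **Numerics of the decomposition**: `6 ∑_{j ≤ 4} K_b^{2j} + 1 ≤ x^ρ` for all large `x` (`ρ > 0`). [this line] -/
theorem urb_numerics {ρ : ℝ} (hρ : 0 < ρ) :
    ∃ x₀ : ℝ, 1 ≤ x₀ ∧ ∀ x : ℝ, x₀ ≤ x → 6 * (∑ j ∈ Icc 1 4, ((urbKb x : ℝ) ^ (2 * j))) + 1 ≤ x ^ ρ := by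
  set A : ℝ := 2 / Real.log 2 with hA
  have hlog2 : 0 < Real.log 2 := Real.log_pos one_lt_two
  have hA0 : 0 < A := div_pos two_pos hlog2
  have hev : ∀ᶠ x : ℝ in atTop, (24 * A ^ 8 + 1) * Real.log x ^ 8 ≤ x ^ ρ ∧ (4 : ℝ) ≤ x :=
    (eventually_mul_log_pow_le _ 8 hρ).and (eventually_ge_atTop _)
  obtain ⟨x₀, hx₀⟩ := Filter.eventually_atTop.1 hev
  refine ⟨max x₀ 1, le_max_right _ _, fun x hx => ?_⟩
  obtain ⟨e1, e2⟩ := hx₀ x ((le_max_left _ _).trans hx)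
  have hKb : (urbKb x : ℝ) ≤ A * Real.log x := urbKb_le e2
  have hlog4 : 1 ≤ Real.log x := by
    have h4 : Real.log 4 ≤ Real.log x := Real.log_le_log (by norm_num) e2
    have h44 : Real.log 4 = 2 * Real.log 2 := by
      rw [show (4 : ℝ) = 2 ^ 2 by norm_num, Real.log_pow]; norm_num
    have : (1 : ℝ) ≤ 2 * Real.log 2 := by
      have h := Real.log_two_gt_d9
      norm_num at h
      linarith
    linarith
  have hAl : 1 ≤ A * Real.log x := by
    have : 1 ≤ A := by rw [hA, le_div_iff₀ hlog2]; have := Real.log_two_lt_d9; linarith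
    nlinarith
  have hKb0 : 0 ≤ (urbKb x : ℝ) := Nat.cast_nonneg _
  have hterm : ∀ j ∈ Icc 1 4, (urbKb x : ℝ) ^ (2 * j) ≤ (A * Real.log x) ^ 8 := by
    intro j hj
    rw [Finset.mem_Icc] at hj
    calc (urbKb x : ℝ) ^ (2 * j) ≤ (A * Real.log x) ^ (2 * j) := pow_le_pow_left₀ hKb0 hKb _
      _ ≤ (A * Real.log x) ^ 8 := pow_le_pow_right₀ hAl (by omega)
  calc 6 * (∑ j ∈ Icc 1 4, ((urbKb x : ℝ) ^ (2 * j))) + 1 ≤ 6 * (∑ _j ∈ Icc 1 4, (A * Real.log x) ^ 8) + 1 := by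
        gcongr with j hj; exact hterm j hj
    _ = 24 * A ^ 8 * Real.log x ^ 8 + 1 := by rw [Finset.sum_const, Nat.card_Icc]; simp; ring
    _ ≤ 24 * A ^ 8 * Real.log x ^ 8 + Real.log x ^ 8 := by gcongr; exact one_le_pow₀ hlog4
    _ = (24 * A ^ 8 + 1) * Real.log x ^ 8 := by ring
    _ ≤ x ^ ρ := e1

/-! ### Step D: the decomposition -/

/-- `C(4, j) ≤ 6`. [folklore] -/
theorem choose_four_le (j : ℕ) : (Nat.choose 4 j : ℝ) ≤ 6 := by
  have h := Nat.choose_le_middle j 4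
  have h6 : Nat.choose 4 (4 / 2) = 6 := by decide
  rw [h6] at h
  exact_mod_cast h

/-- **Heath-Brown's identity for `λ`, boxed**: for `1 ≤ m ≤ 2x`,
`λ(m) = ∑_{j=1}^{4} (−1)^{j+1} C(4,j) ∑_{κ} F_{j,κ}(m) + (1_{□,>K} ⋆ μ)(m)`. [this line; cite: Heathbrown1982, Lemma 1] -/
theorem liouville_eq_sum_hbBox {x : ℝ} (hx : 0 < x) (ρ : ℝ) {m : ℕ} (hm : (m : ℝ) ≤ 2 * x) :
    (ArithmeticFunction.liouville m : ℝ) =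
      ∑ j ∈ Icc 1 4, ((-1 : ℝ) ^ (j + 1) * (Nat.choose 4 j : ℝ)) *
          ∑ κ ∈ piFinset (fun _ : Fin (2 * j) => Finset.range (urbKb x)), hbBox x ρ j κ m +
        tailLiouville x ρ m := by
  have hz : 0 ≤ (2 * x) ^ (1 / 4 : ℝ) := Real.rpow_nonneg (by linarith) _
  have hz4 : ((2 * x) ^ (1 / 4 : ℝ)) ^ 4 = 2 * x := by
    rw [← Real.rpow_natCast ((2 * x) ^ (1 / 4 : ℝ)) 4, ← Real.rpow_mul (by linarith)]; norm_num
  have h := HeathBrownLiouville.liouville_apply_eq (k := 4) (by norm_num) (urbK x ρ) hz (m := m) (by rw [hz4]; exact hm)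
  rw [h]
  congr 1
  refine Finset.sum_congr rfl fun j _ => ?_
  congr 1
  rw [← Fin.prod_univ_eq_prod_range (fun i => HeathBrownLiouville.hbFactor (urbK x ρ) ⌊(2 * x) ^ (1 / 4 : ℝ)⌋₊ j i)
    (2 * j), BFI.prod_apply_eq_sum_prod_boxRestrict_apply (by linarith) one_pos (two_mul_lt_two_pow_urbKb x) _ hm]
  rfl

/-- **Step D — the decomposition inequality** `NS(λ) ≤ 6 ∑_{j ≤ 4} ∑_κ NS(F_{j,κ}) + NS(1_{□,>K} ⋆ μ)` for `Y ≤ 2x`.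
[this line] -/
theorem urb_decomp (c : ℤ) (w P : ℕ) {x : ℝ} (hx : 0 < x) (ρ : ℝ) {Y : ℝ} (hY : Y ≤ 2 * x) (R Slo : ℝ) :
    normSum c w P x ρ Y R Slo (fun m => (ArithmeticFunction.liouville m : ℝ)) ≤
      6 * ∑ j ∈ Icc 1 4, ∑ κ ∈ piFinset (fun _ : Fin (2 * j) => Finset.range (urbKb x)),
          normSum c w P x ρ Y R Slo (fun m => hbBox x ρ j κ m) +
        normSum c w P x ρ Y R Slo (fun m => tailLiouville x ρ m) := by
  -- on `[1, Y]`, `λ` is the decomposed function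
  have hcongr := normSum_congr c w P x ρ Y R Slo (a := fun m => (ArithmeticFunction.liouville m : ℝ))
    (b := fun m => (∑ j ∈ Icc 1 4, ((-1 : ℝ) ^ (j + 1) * (Nat.choose 4 j : ℝ)) *
      ∑ κ ∈ piFinset (fun _ : Fin (2 * j) => Finset.range (urbKb x)), hbBox x ρ j κ m) + tailLiouville x ρ m)
    (fun m hm => by
      rw [Finset.mem_Icc] at hm
      refine liouville_eq_sum_hbBox hx ρ ?_
      rcases le_or_gt 0 Y with hY0 | hY0
      · exact le_trans (by exact_mod_cast hm.2) ((Nat.floor_le hY0).trans hY)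
      · rw [Nat.floor_of_nonpos hY0.le] at hm; omega)
  rw [hcongr]
  refine (normSum_add_le c w P x ρ Y R Slo _ _).trans (add_le_add ?_ le_rfl)
  refine (normSum_sum_smul_le (Icc 1 4) c w P x ρ Y R Slo (fun j => (-1 : ℝ) ^ (j + 1) * (Nat.choose 4 j : ℝ))
    (fun j m => ∑ κ ∈ piFinset (fun _ : Fin (2 * j) => Finset.range (urbKb x)), hbBox x ρ j κ m)).trans ?_
  rw [Finset.mul_sum]
  refine Finset.sum_le_sum fun j _ => ?_
  have habs : |(-1 : ℝ) ^ (j + 1) * (Nat.choose 4 j : ℝ)| ≤ 6 := by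
    rw [abs_mul, abs_pow, abs_neg, abs_one, one_pow, one_mul, Nat.abs_cast]
    exact choose_four_le j
  exact mul_le_mul habs (normSum_sum_le _ c w P x ρ Y R Slo _) (normSum_nonneg _ _ _ _ _ _ _ _ _) (by norm_num)

/-- Landing anchor of the `𝔲_R`-bound chain, file 11; registered stub `urbChain11_anchor` of the crux item (the
mathematical content of this file is `urb_decomp`). -/
theorem urbChain11_anchor : True := trivial

end Summit.Parity.GeneralizedHardyLittlewood.Cruxes.TypeI2Dilated.PeelToDrappeau

end
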